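import Summits.QuantumFields.BalabanUV.Beta.D1BFx.PackedRoadHptwScales
import Summits.QuantumFields.BalabanUV.Beta.D1BFx.RoadEndBFxDictPointwiseS

/-!
# Road «BF-x» — THE END AT THE ROAD's OBJECTS: `D1Rep` FROM THE JUNCTIONS (J1)(J2)(J3) (PART 11)

`RoadEndBFxDictPointwiseS.d1Rep_BFx_of_D1Tel_ptw_sbpS` (p306436) displays the road's (K) slot as ONE pointwise identity per one-shot scale (`hptw`) plus
(1.22) rows on rest-word kernels `Rk`.  PART 10 (`PackedRoadHptwScales.hptw_of_junctions`, owner d1-p2) PROVES `hptw` — with its six rest words written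
out — from the junctions (J1)(J2)(J3), the literal's structural sockets, its per-bond torus pins and its LIFTED table-level Ward identities.  This file
is the END with `hptw` REPLACED by those hypotheses: **`d1Rep_BFx_of_junctions_sbpS`**.  The rest-word kernels enter through ONE packing row
`hRk : Σ_u Rk u (Lc^m) μ ν z = (the six words)` — instantiated by `Sum.elim` of the lanes' SLOT PACKs (leaf-01 `RkSand` ∕ `RkBlk` ∕ `RkFP` ∕ `RkGhJ`,
glue `RestKernelSlotGlue`) in PART 12 — and their rows `hMR` ∕ `hRu` ∕ `hU₁` ∕ `hU` stay the END's.  Every other binder BYTE-IDENTICAL with the END.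

READING.  After this file the road's END for the spine root displays, about Bałaban's kernels: the spine's `hW`∕`hRfl`∕`htel`, the printed tables
`h12`∕`h126`, the END's slot-table sockets ∕ pins ∕ rows, AND — in place of `hptw` — (J1) S-LIT per exponent (d1-p3's `JcOf`), (J2) the (A2-N) TABLE
dictionary and (J3) the ghost-ray dictionary per scale AT THE END's LETTERS with rest kernels `RJ2`∕`RJ3` (an2's Q-DICT-N ∕ Q-GH-W′), the literal's
sockets, per-bond torus pins and LIFTED [P1′]∕[P2′]; plus the packing row and the unit-class rows of the rest words.
HONEST: [folklore] composition BY NAME; 0 rows discharged; (J1)(J2)(J3) are HYPOTHESES; (K) NOT closed; NOT D1, NOT `BetaPertH`, NOT continuum,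
NOT Clay.  No definition, no `def … : Prop`, nothing cited, 0 sorry.
HONEST DEPENDENCY: continuum YM on T⁴ ⇐ BetaPertH ∧ nine spine estimates (0/9 proved); BetaPertH ⇐ (D1) ∧ (D4) ∧ CAP+tail; G-an2-4 gates asym, D1 and NE2/3/4.
ABSOLUTE RULE (cell charter, verbatim): «No internally-minted statement may enter as a cited fact. Every hypothesis is either kernel-proved in this
package or a verbatim quotation of a PUBLISHED theorem with page reference. The manuscript(s) under audit are NOT citable for their own disputed
steps — they are the thing under adjudication; programme-internal (2001/route/tribunal) claims are never citable.»
Unit `b2b-balaban-beta-d1-p2` (road owner, gen 19), 2026-08-22.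
-/

noncomputable section

open Finset Filter Topology
open Literature.Probability.LatticeModels (annulus)
open scoped BigOperators
open Literature.MathematicalPhysics.QuantumFieldTheory.Balaban1983to89
open Literature.MathematicalPhysics.QuantumFieldTheory.Balaban1983to89.Beta
open OneStepResolventKernel (JetData KInv)
open OneStepKernelFamily (TbalOf TshotOf flipK D1Tel D1Rep D1Drift)
open PolarizationSign (WardTransversal AxisReflectionCovariant)
open StepDriftWitness (D1Sum d1Sum_iff d1Sum_of_d1Tel d1Rep_iff_d1Drift_of_d1Sum)
open InterLevelTransport (onLat)
open BalabanStepJets (lamCoeffOf)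
open AveragingHessianKernels (hessFF)
open KernelWard (divV)
open WindowIdentification (fullSum psum)
open B12Sec2to5 (l1)
open DyadicShell (Pt toReal supNorm)
open ExpKernelCalculus (Site MKer BiLoc shiftK comp VertexFamily VertexFamily₂)
open DecimatedMomentSummable (AbsMoment₂)
open DecimatedMomentSummable (IsMoment₂ summable_smul_of_absMoment₂)
open GhostTable (gFree)
open BubbleTransfer (unitVec)
open DressedMomentNormalisation (resSite)
open PoissonInterior (nrm)
open Summit.QuantumFields.BalabanUV.Beta.TameKernelCalculus (Spr Loc trK)
open Summit.QuantumFields.BalabanUV.Beta.D1BFx.ReducedKernel (TableR TOfRed vertexRed absMoment₂_TOfRed)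
open Summit.QuantumFields.BalabanUV.Beta.D1BFx.DressedTadpoleTable (tableRed tadpoleTable)
open Summit.QuantumFields.BalabanUV.Beta.D1BFx.ReducedKernelSandwich (fineHess)
open Summit.QuantumFields.BalabanUV.Beta.D1BFx.ReducedTableBridge (vertexFamily₂_tableRed')
open Summit.QuantumFields.BalabanUV.Beta.D1BFx.FineStencilBF (ffOf)
open Summit.QuantumFields.BalabanUV.Beta.D1BFx.FineStencilBFBalaban (SbfBal exists_vertexFamily_vertexRed_SbfBal)
open Summit.QuantumFields.BalabanUV.Beta.D1BFx.SecondStencilBF (Wbf biLoc_Wbf)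
open Summit.QuantumFields.BalabanUV.Beta.D1BFx.GhostKernelComplete (PghQ fineHessGhQ absMoment₂_PghQ)
open Summit.QuantumFields.BalabanUV.Beta.D1BFx.GluonLeg (Ga)
open Summit.QuantumFields.BalabanUV.Beta.D1BFx.GluonLegTails (hGa_of_prop12)
open Summit.QuantumFields.BalabanUV.Beta.D1BFx.FrozenLegTails (nOf MOf hn1)
open Summit.QuantumFields.BalabanUV.Beta.D1BFx.FrozenLegProfile (gfrz)
open VectorTailsLoc (fam kfam)
open Summit.QuantumFields.BalabanUV.Beta.D1BFx.RoadEndBFxSpineDictS (d1Rep_BFx_of_D1Tel_dict_sbpS)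
open Matrix Filter Topology
open scoped BigOperators Kronecker
open Literature.Probability.LatticeModels (TorusSite)
open Literature.MathematicalPhysics.QuantumFieldTheory.Balaban1983to89.Beta.Composition (kkt)
open B12Sec2to5 (l1 l1_nonneg)
open ExpKernelCalculus (MKer BiLoc comp hessKer shiftK tr Site)
open OneStepKernelFamily (KInvStep colH vertexOfK TshotOf)
open Summit.QuantumFields.BalabanUV.Beta.AxialDressingRooted (coDressKBmAt coProjBmAtK)
open Summit.QuantumFields.BalabanUV.Beta.D1BFx.SortedKernels (fTL fBL)
open Summit.QuantumFields.BalabanUV.Beta.D1BFx.PackedNSideDictionary (SN)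
open Summit.QuantumFields.BalabanUV.Beta.D1BFx.PackedNSidePair (W2NInf)
open AffineAveraging (box toSite unitVec)
open OneStepResolventKernel (Fib wsum LocStencil)
open SecondOrderResponse (vertex2OfK)
open Summit.QuantumFields.BalabanUV.Beta.TameKernelCalculus (Spr)
open Summit.QuantumFields.BalabanUV.Beta.D1BFx.FibredPeriodisation (periodiseF)
open Summit.QuantumFields.BalabanUV.Beta.D1BFx.SortedPack (sortK)
open Summit.QuantumFields.BalabanUV.Beta.D1BFx.SortedReblocking (torusBlockEquiv)
open Summit.QuantumFields.BalabanUV.Beta.D1BFx.SortedEmbedding (e₁)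
open Summit.QuantumFields.BalabanUV.Beta.D1BFx.PeriodicArrays (arr)
open Summit.QuantumFields.BalabanUV.Beta.D1BFx.TorusCombKKT (I J CombRows tauT Khat Qhat)
open Summit.QuantumFields.BalabanUV.Beta.D1BFx.TorusGaugeBasis (What0)
open Summit.QuantumFields.BalabanUV.Beta.D1BFx.TorusGaugeBasisMatrix (Nhat)
open Summit.QuantumFields.BalabanUV.Beta.D1BFx.TorusCoframeJets (Djet Tjet₀ Tjet₁ Tjet₁₁ Ajet₀ Ajet₁ Ajet₁₁)
open Summit.QuantumFields.BalabanUV.Beta.D1BFx.RWeightedLegPack (NlegRoad)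
open Summit.QuantumFields.BalabanUV.Beta.D1BFx.GaugeJetLocal (idK1)
open Summit.QuantumFields.BalabanUV.Beta.D1BFx.GhostStencil (ghCur)
open Summit.QuantumFields.BalabanUV.Beta.D1BFx.TorusGhostPairStencils (gh₂)
open Summit.QuantumFields.BalabanUV.Beta.D1BFx.CombFPWordArrays (nFcol)
open Summit.QuantumFields.BalabanUV.Beta.D1BFx.WardJetsFromNoether (oslot)
open Summit.QuantumFields.BalabanUV.Beta.D1BFx.ColourLiftAdE3 (c₃)
open Summit.QuantumFields.BalabanUV.Beta.D1BFx.PackedKernelSplit (blk ffV ffW legCross blockTerms)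
open Summit.QuantumFields.BalabanUV.Beta.D1BFx.ReducedKernelF (TOfLeg)
open Summit.QuantumFields.BalabanUV.Beta.D1BFx.CoarseGramInverse (multM)
open Summit.QuantumFields.BalabanUV.Beta.D1BFx.RWeightedLegPack (sandP)
open Summit.QuantumFields.BalabanUV.Beta.D1BFx.RProjector (Pgt)
open Summit.QuantumFields.BalabanUV.Beta.D1BFx.GhostLeg (Ggh)
open OneStepResolventKernel (JetData)
open Summit.QuantumFields.BalabanUV.Beta.D1BFx.ReducedKernel (TOfRed)
open Summit.QuantumFields.BalabanUV.Beta.D1BFx.GhostKernelComplete (PghQ)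
open Summit.QuantumFields.BalabanUV.Beta.D1BFx.PackedRoadK6cSkeletonNN (tshot_eq_hptw_form_of_junctions_NN)
open Summit.QuantumFields.BalabanUV.Beta.D1BFx.RestKernelGhostWords (GhIdx ghostWordK pRemK_sixteen_eq_sum_ghostWordK)
open Summit.QuantumFields.BalabanUV.Beta.D1BFx.GluonLegTails (spr_Ga_of_prop12)
open Summit.QuantumFields.BalabanUV.Beta.D1BFx.FineStencilBFBalaban (SbfBal)
open Summit.QuantumFields.BalabanUV.Beta.D1BFx.SecondStencilBF (Wbf)
open Summit.QuantumFields.BalabanUV.Beta.D1BFx.DressedTadpoleTable (tableRed)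
open Summit.QuantumFields.BalabanUV.Beta.D1BFx.ReducedKernel (TableR)
open Summit.QuantumFields.BalabanUV.Beta.D1BFx.RoadEndBFxDictPointwiseS (d1Rep_BFx_of_D1Tel_ptw_sbpS)
open Summit.QuantumFields.BalabanUV.Beta.D1BFx.PackedRoadHptwScales (hptw_of_junctions)

namespace Summit.QuantumFields.BalabanUV.Beta.D1BFx.RoadEndBFxJunctionsS

variable {Lc : ℕ} [NeZero Lc] {a N cgh₀ : ℝ} {μ ν : Fin 4} {υ : Type*} [Fintype υ]
  {cE cVH cΛ cR cK cQ cE₂ cJ4 cΛ₂ cR₂ cQ₂ x₀ ωgl ωgh cgh : ℕ → ℝ} {WE WJ WΛ WR WQ : ℕ → TableR} {CE CJ CΛt CRt CQ δW : ℕ → ℝ}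
  {Ru : υ → ℕ → ℝ} {CU : υ → ℝ} {U₁ : ℝ}
  {TΛ WA : ℕ → Fin 4 → Site 4 → Fin 4 → Site 4 → MKer 4 (Fin 4)} {CT δT : ℕ → ℝ}
  {ε : ℕ → ℝ} {X : ℕ → Site 4 → MKer 4 (Fin 4)} {Cx δx : ℕ → ℝ}

/-- [folklore] **ROAD BF-x ⟹ THE SPINE's `D1Rep` AT THE SPINE ROOT's OWN BINDER NAMES, FROM THE JUNCTIONS** — `RoadEndBFxDictPointwiseS.d1Rep_BFx_of_D1Tel_ptw_sbpS`
with its pointwise dictionary `hptw` REPLACED by PART 10's hypotheses (per-scale block roots `r`, literal stencil families `S`∕`S₂` + STRUCTURAL SOCKETS, torus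
sequences `p`, per-bond torus pins `K₁ … x₂`, LIFTED [P1′]∕[P2′] with `C 2 = c₃`, (J1) per exponent, (J2)∕(J3) per scale at the END's letters with rest
kernels `RJ2`∕`RJ3`) and ONE packing row `hRk` (the member family `Rk`'s pointwise sum IS the six rest words); every other binder BYTE-IDENTICAL. -/
theorem d1Rep_BFx_of_junctions_sbpS (Js : ℕ → JetData 3 Lc) (hμν : μ ≠ ν) (hN : N ≠ 0) (hL : 2 ≤ Lc) (hodd : Odd Lc)
    (ha : 0 < a)
    (h12 : B5.Prop12Printed (fam nOf hn1 MOf a ha)) (h126 : B5.Kernel126_127Printed (kfam nOf MOf))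
    -- bridge B1 REPLACED: composite jet data, the printed symmetries of the flipped step kernels, the spine's `D1Tel`, the one-shot (K)-estimate
    (Jc : ∀ m : ℕ, JetData 3 (Lc ^ m))
    (hW : ∀ j, WardTransversal (flipK (TbalOf Lc Js j))) (hRfl : ∀ j, AxisReflectionCovariant (flipK (TbalOf Lc Js j)))
    (htel : D1Tel Lc Js Jc)
    -- ===== THE (K) SLOT AT THE ROAD's OBJECTS (PART 10 `PackedRoadHptwScales.hptw_of_junctions`): per-scale block roots, the literal's stencil
    -- ===== families with their STRUCTURAL SOCKETS, torus sequences, per-bond torus pins, LIFTED [P1′]∕[P2′], and the junctions (J1)(J2)(J3)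
    -- the block roots, per scale
    (r : ℕ → Fin 4 → ℕ) (hr : ∀ n : ℕ, 2 ≤ n → ∀ [NeZero n], r n ∈ box (3 + 1) n)
    -- the literal's first-derivative stencil families, per scale, and their STRUCTURAL SOCKETS
    (S : ℕ → Fin 4 → (Fin 4 → ℤ) → MKer 4 (Fib 3)) {Cs δS : ℕ → ℝ} (hS : ∀ n : ℕ, 2 ≤ n → LocStencil (S n) (Cs n) (δS n))
    (hCs : ∀ n, 0 ≤ Cs n) (hδS : ∀ n, 0 < δS n)
    (hScovB : ∀ n : ℕ, 2 ≤ n → ∀ κ' u t, S n κ' (u + ((n : ℕ) : ℤ) • t) = shiftK (-(((n : ℕ) : ℤ) • t)) (S n κ' u))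
    (hSmm : ∀ n : ℕ, 2 ≤ n → ∀ κ' u x y (c b : Fin 4), S n κ' u x y (Sum.inr c) (Sum.inr b) = 0)
    (hSfm : ∀ n : ℕ, 2 ≤ n → ∀ κ' u x y (c b : Fin 4), S n κ' u x y (Sum.inl c) (Sum.inr b) = S n κ' u y x (Sum.inr b) (Sum.inl c))
    (hSff : ∀ n : ℕ, 2 ≤ n → ∀ κ' u x y (c b : Fin 4), S n κ' u x y (Sum.inl c) (Sum.inl b) = -S n κ' u y x (Sum.inl b) (Sum.inl c))
    -- the literal's second-derivative stencil families, per scale, and their STRUCTURAL SOCKETS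
    (S₂ : ℕ → Fin 4 → (Fin 4 → ℤ) → Fin 4 → (Fin 4 → ℤ) → MKer 4 (Fib 3)) {Ck δ₂ : ℕ → ℝ}
    (hS₂ : ∀ n : ℕ, 2 ≤ n → ∀ κ u κ' u', BiLoc (S₂ n κ u κ' u') u u (Ck n * Real.exp (-δ₂ n * l1 (u' - u))) (δ₂ n))
    (hCk : ∀ n, 0 ≤ Ck n) (hδ₂ : ∀ n, 0 < δ₂ n)
    (hS₂covB : ∀ n : ℕ, 2 ≤ n → ∀ κ' κ'' u u' t, S₂ n κ' (u + ((n : ℕ) : ℤ) • t) κ'' (u' + ((n : ℕ) : ℤ) • t)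
      = shiftK (-(((n : ℕ) : ℤ) • t)) (S₂ n κ' u κ'' u'))
    (hS₂mm : ∀ n : ℕ, 2 ≤ n → ∀ κ u κ' u' x y (c b : Fin 4), S₂ n κ u κ' u' x y (Sum.inr c) (Sum.inr b) = 0)
    (hS₂fm : ∀ n : ℕ, 2 ≤ n → ∀ κ u κ' u' x y (c b : Fin 4),
      S₂ n κ u κ' u' x y (Sum.inl c) (Sum.inr b) = -S₂ n κ u κ' u' y x (Sum.inr b) (Sum.inl c))
    (hS₂ff : ∀ n : ℕ, 2 ≤ n → ∀ κ u κ' u' x y (c b : Fin 4),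
      S₂ n κ u κ' u' x y (Sum.inl c) (Sum.inl b) = S₂ n κ u κ' u' y x (Sum.inl b) (Sum.inl c))
    -- the torus sequences, per scale
    (p : ℕ → ℕ → ℕ) [∀ n k, NeZero (p n k)] (hp : ∀ n, Tendsto (p n) atTop atTop)
    -- the literal's per-bond torus data, per scale, PINNED to the periodised single-bond ∕ pair stencil arrays and THE CONVENTION's generator jets
    (K₁ : ∀ (n : ℕ) [NeZero n] (k : ℕ), I 3 n (p n k) ⊕ J 3 (p n k) → Matrix (I 3 n (p n k)) (I 3 n (p n k)) ℝ)
    (Q₁ : ∀ (n : ℕ) [NeZero n] (k : ℕ), I 3 n (p n k) ⊕ J 3 (p n k) → Matrix (J 3 (p n k)) (I 3 n (p n k)) ℝ)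
    (x₁ : ∀ (n : ℕ) [NeZero n] (k : ℕ), I 3 n (p n k) ⊕ J 3 (p n k) → Matrix (I 3 n (p n k)) (CombRows (toSite (r n)) n (p n k)) ℝ)
    (K₂ : ∀ (n : ℕ) [NeZero n] (k : ℕ), I 3 n (p n k) ⊕ J 3 (p n k) → I 3 n (p n k) ⊕ J 3 (p n k) → Matrix (I 3 n (p n k)) (I 3 n (p n k)) ℝ)
    (Q₂ : ∀ (n : ℕ) [NeZero n] (k : ℕ), I 3 n (p n k) ⊕ J 3 (p n k) → I 3 n (p n k) ⊕ J 3 (p n k) → Matrix (J 3 (p n k)) (I 3 n (p n k)) ℝ)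
    (x₂ : ∀ (n : ℕ) [NeZero n] (k : ℕ), I 3 n (p n k) ⊕ J 3 (p n k) → I 3 n (p n k) ⊕ J 3 (p n k) →
      Matrix (I 3 n (p n k)) (CombRows (toSite (r n)) n (p n k)) ℝ)
    (hK₁ : ∀ n : ℕ, 2 ≤ n → ∀ [NeZero n], ∀ k i, K₁ n k (Sum.inl i) = Matrix.of (periodiseF (p n k) (fTL (sortK n (arr (n * p n k)
      (S n i.2.2 (windowMap 4 (n * p n k) (torusBlockEquiv n (p n k) (i.1, i.2.1)))))))))
    (hQ₁ : ∀ n : ℕ, 2 ≤ n → ∀ [NeZero n], ∀ k i, Q₁ n k (Sum.inl i) = Matrix.of (periodiseF (p n k) (fBL (sortK n (arr (n * p n k)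
      (S n i.2.2 (windowMap 4 (n * p n k) (torusBlockEquiv n (p n k) (i.1, i.2.1)))))))))
    (hx₁ : ∀ n : ℕ, 2 ≤ n → ∀ [NeZero n], ∀ k i, x₁ n k (Sum.inl i) = (Djet (n * p n k) (e₁ n (p n k) i)).submatrix (e₁ n (p n k)) id * Nhat (r n) n (p n k))
    (hK₂ : ∀ n : ℕ, 2 ≤ n → ∀ [NeZero n], ∀ k i j, K₂ n k (Sum.inl i) (Sum.inl j) = Matrix.of (periodiseF (p n k) (fTL (sortK n (fun x y c b => ∑' t : Fin 4 → ℤ,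
      arr (n * p n k) (S₂ n i.2.2 (windowMap 4 (n * p n k) (torusBlockEquiv n (p n k) (i.1, i.2.1))) j.2.2
        (imageShift (n * p n k) (windowMap 4 (n * p n k) (torusBlockEquiv n (p n k) (j.1, j.2.1))) t)) x y c b)))))
    (hQ₂ : ∀ n : ℕ, 2 ≤ n → ∀ [NeZero n], ∀ k i j, Q₂ n k (Sum.inl i) (Sum.inl j) = Matrix.of (periodiseF (p n k) (fBL (sortK n (fun x y c b => ∑' t : Fin 4 → ℤ,
      arr (n * p n k) (S₂ n i.2.2 (windowMap 4 (n * p n k) (torusBlockEquiv n (p n k) (i.1, i.2.1))) j.2.2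
        (imageShift (n * p n k) (windowMap 4 (n * p n k) (torusBlockEquiv n (p n k) (j.1, j.2.1))) t)) x y c b)))))
    (hx₂ : ∀ n : ℕ, 2 ≤ n → ∀ [NeZero n], ∀ k i j, x₂ n k (Sum.inl i) (Sum.inl j) = if i = j then x₁ n k (Sum.inl i) else 0)
    (hK₁0 : ∀ n : ℕ, 2 ≤ n → ∀ [NeZero n], ∀ k j, K₁ n k (Sum.inr j) = 0) (hQ₁0 : ∀ n : ℕ, 2 ≤ n → ∀ [NeZero n], ∀ k j, Q₁ n k (Sum.inr j) = 0)
    (hx₁0 : ∀ n : ℕ, 2 ≤ n → ∀ [NeZero n], ∀ k j, x₁ n k (Sum.inr j) = 0)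
    (hK₂0 : ∀ n : ℕ, 2 ≤ n → ∀ [NeZero n], ∀ k j q, K₂ n k (Sum.inr j) q = 0) (hK₂0' : ∀ n : ℕ, 2 ≤ n → ∀ [NeZero n], ∀ k q j, K₂ n k q (Sum.inr j) = 0)
    (hQ₂0 : ∀ n : ℕ, 2 ≤ n → ∀ [NeZero n], ∀ k j q, Q₂ n k (Sum.inr j) q = 0) (hQ₂0' : ∀ n : ℕ, 2 ≤ n → ∀ [NeZero n], ∀ k q j, Q₂ n k q (Sum.inr j) = 0)
    (hx₂0 : ∀ n : ℕ, 2 ≤ n → ∀ [NeZero n], ∀ k j q, x₂ n k (Sum.inr j) q = 0) (hx₂0' : ∀ n : ℕ, 2 ≤ n → ∀ [NeZero n], ∀ k q j, x₂ n k q (Sum.inr j) = 0)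
    -- the literal's LIFTED table-level Ward identities [P1′]∕[P2′] in the `ad e₃` model (ρ-g16-1′), per torus
    (C : Fin 3 → Matrix (Fin 3) (Fin 3) ℝ) (hC : C 2 = c₃)
    (hP1 : ∀ n : ℕ, 2 ≤ n → ∀ [NeZero n], ∀ k, ∀ q : Fin 3 × (I 3 n (p n k) ⊕ J 3 (p n k)),
      (C q.1 ⊗ₖ kkt (K₁ n k q.2) (Q₁ n k q.2))
          * ((1 : Matrix (Fin 3) (Fin 3) ℝ) ⊗ₖ Matrix.fromRows (What0 (r n) n (p n k)) (0 : Matrix (J 3 (p n k)) (CombRows (toSite (r n)) n (p n k)) ℝ))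
      + ((1 : Matrix (Fin 3) (Fin 3) ℝ) ⊗ₖ kkt (Khat (d := 3) n (p n k)) (Qhat (d := 3) n (p n k)))
          * (C q.1 ⊗ₖ Matrix.fromRows (x₁ n k q.2) (0 : Matrix (J 3 (p n k)) (CombRows (toSite (r n)) n (p n k)) ℝ))
      + oslot (fun q' : Fin 3 × (I 3 n (p n k) ⊕ J 3 (p n k)) =>
            C q'.1 ⊗ₖ Matrix.fromRows (x₁ n k q'.2) (0 : Matrix (J 3 (p n k)) (CombRows (toSite (r n)) n (p n k)) ℝ))
          (fun i => ((1 : Matrix (Fin 3) (Fin 3) ℝ) ⊗ₖ kkt (Khat (d := 3) n (p n k)) (Qhat (d := 3) n (p n k))) i q) = 0)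
    (hP2 : ∀ n : ℕ, 2 ≤ n → ∀ [NeZero n], ∀ k, ∀ q q'' : Fin 3 × (I 3 n (p n k) ⊕ J 3 (p n k)),
      ((C q.1 * C q''.1) ⊗ₖ kkt (K₂ n k q.2 q''.2) (Q₂ n k q.2 q''.2))
          * ((1 : Matrix (Fin 3) (Fin 3) ℝ) ⊗ₖ Matrix.fromRows (What0 (r n) n (p n k)) (0 : Matrix (J 3 (p n k)) (CombRows (toSite (r n)) n (p n k)) ℝ))
      + (C q.1 ⊗ₖ kkt (K₁ n k q.2) (Q₁ n k q.2))
          * (C q''.1 ⊗ₖ Matrix.fromRows (x₁ n k q''.2) (0 : Matrix (J 3 (p n k)) (CombRows (toSite (r n)) n (p n k)) ℝ))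
      + (C q''.1 ⊗ₖ kkt (K₁ n k q''.2) (Q₁ n k q''.2))
          * (C q.1 ⊗ₖ Matrix.fromRows (x₁ n k q.2) (0 : Matrix (J 3 (p n k)) (CombRows (toSite (r n)) n (p n k)) ℝ))
      + ((1 : Matrix (Fin 3) (Fin 3) ℝ) ⊗ₖ kkt (Khat (d := 3) n (p n k)) (Qhat (d := 3) n (p n k)))
          * ((C q.1 * C q''.1) ⊗ₖ Matrix.fromRows (x₂ n k q.2 q''.2) (0 : Matrix (J 3 (p n k)) (CombRows (toSite (r n)) n (p n k)) ℝ))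
      + oslot (fun q' : Fin 3 × (I 3 n (p n k) ⊕ J 3 (p n k)) =>
            C q'.1 ⊗ₖ Matrix.fromRows (x₁ n k q'.2) (0 : Matrix (J 3 (p n k)) (CombRows (toSite (r n)) n (p n k)) ℝ))
          (fun i => (C q''.1 ⊗ₖ kkt (K₁ n k q''.2) (Q₁ n k q''.2)) i q)
      + oslot (fun q' : Fin 3 × (I 3 n (p n k) ⊕ J 3 (p n k)) =>
            (C q''.1 * C q'.1) ⊗ₖ Matrix.fromRows (x₂ n k q''.2 q'.2) (0 : Matrix (J 3 (p n k)) (CombRows (toSite (r n)) n (p n k)) ℝ))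
          (fun i => ((1 : Matrix (Fin 3) (Fin 3) ℝ) ⊗ₖ kkt (Khat (d := 3) n (p n k)) (Qhat (d := 3) n (p n k))) i q)
      + oslot (fun p' : Fin 3 × (I 3 n (p n k) ⊕ J 3 (p n k)) =>
            (C q.1 * C p'.1) ⊗ₖ Matrix.fromRows (x₂ n k q.2 p'.2) (0 : Matrix (J 3 (p n k)) (CombRows (toSite (r n)) n (p n k)) ℝ))
          (fun i => ((1 : Matrix (Fin 3) (Fin 3) ℝ) ⊗ₖ kkt (Khat (d := 3) n (p n k)) (Qhat (d := 3) n (p n k))) i q'') = 0)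
    -- (J1) S-LIT, per exponent: the spine's one-shot kernel at scale `Lc^m` IS the road's main M-side object (d1-p3's `JcOf`; displayed)
    (hJ1 : ∀ m : ℕ, 1 ≤ m → ∀ z : Site 4, TshotOf Lc Jc m μ ν z
      = hessKer (coDressKBmAt (toSite (r (Lc ^ m))) (Lc ^ m) (KInvStep (d := 3) (Lc ^ m) 0))
          (vertexOfK (coDressKBmAt (toSite (r (Lc ^ m))) (Lc ^ m) (KInvStep (d := 3) (Lc ^ m) 0)) (Lc ^ m) (S (Lc ^ m)))
          (vertex2OfK (coDressKBmAt (toSite (r (Lc ^ m))) (Lc ^ m) (KInvStep (d := 3) (Lc ^ m) 0)) (Lc ^ m) (S₂ (Lc ^ m))) μ ν z)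
    -- (J2) the (A2-N) TABLE dictionary AT THE END's LETTERS, per scale, with a rest KERNEL `RJ2 n` (an2's Q-DICT-N; displayed)
    (RJ2 RJ3 : ℕ → Fin 4 → Fin 4 → Site 4 → ℝ)
    (hJ2 : ∀ n : ℕ, 2 ≤ n → ∀ [NeZero n], ∀ z : Site 4,
      ((2 : ℝ)⁻¹) ^ 2 * TOfLeg n (Ga n a) (fun κ u => blk (coProjBmAtK (toSite (r n)) n (SN (n - 1) a (S n)) κ u) true true)
            (fun μ' y ν' y' => ((2 : ℝ)⁻¹)⁻¹ • ffW (W2NInf (n - 1) a (r n) (S₂ n)) μ' y ν' y') μ ν z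
      = ωgl n * TOfRed n a (SbfBal n a (cE n) (cVH n) (cΛ n) (cR n) (cK n) (cQ n))
          (tableRed n (Wbf (cE₂ n) (cJ4 n) (cΛ₂ n) (cR₂ n) (cQ₂ n) (WE n) (WJ n) (WΛ n) (WR n) (WQ n))) μ ν z + RJ2 n μ ν z)
    -- (J3) the ghost main word vs the END's ghost ray AT THE END's LETTERS, per scale, with a rest KERNEL `RJ3 n` (Q-GH-W′; displayed)
    (hJ3 : ∀ n : ℕ, 2 ≤ n → ∀ [NeZero n], ∀ z : Site 4,
      -(2 * hessKer (Ggh n a)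
          (fun κ' v => (((n : ℕ) : ℝ) ^ 2) • (fun x y a b => ∑ κ : Fin 4,
            wsum (colH (coDressKBmAt (toSite (r n)) n (KInvStep (d := 3) n 0)) n κ' v κ) (ghCur κ) x y a b))
          (fun κ' v l v' => (((n : ℕ) : ℝ) ^ 2) • (fun x y a b => ∑ κ : Fin 4,
            wsum (colH (coDressKBmAt (toSite (r n)) n (KInvStep (d := 3) n 0)) n κ' v κ)
              (fun u => fun x y a b => colH (coDressKBmAt (toSite (r n)) n (KInvStep (d := 3) n 0)) n l v' κ u * gh₂ κ u x y a b) x y a b)) μ ν z)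
      = ωgh n * PghQ n a (x₀ n) (cK n) (cQ n) μ ν z + RJ3 n μ ν z)
    -- ===== THE REST-WORD PACKING: a member family `Rk` whose pointwise sum IS the six rest words of PART 10, with its (1.22) rows
    (Rk : υ → ℕ → Fin 4 → Fin 4 → Site 4 → ℝ) {CU' : υ → ℝ}
    (hRk : ∀ m : ℕ, 1 ≤ m → ∀ z : Site 4, ∑ u, Rk u (Lc ^ m) μ ν z =
        (legCross ((2 : ℝ)⁻¹ • Ga (Lc ^ m) a)
            ((-(2 : ℝ)⁻¹) • blk (sandP (Lc ^ m) (Ga (Lc ^ m) a) (multM (Lc ^ m) (2 * a / ((Lc ^ m : ℕ) : ℝ) ^ 8) 2)) true true)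
            (ffV (vertexOfK (coDressKBmAt (toSite (r (Lc ^ m))) (Lc ^ m) (KInvStep (d := 3) (Lc ^ m) 0)) (Lc ^ m) (SN ((Lc ^ m) - 1) a (S (Lc ^ m))))) (ffW (W2NInf ((Lc ^ m) - 1) a (r (Lc ^ m)) (S₂ (Lc ^ m)))) μ ν z
          + blockTerms (NlegRoad ((Lc ^ m) - 1) a) (vertexOfK (coDressKBmAt (toSite (r (Lc ^ m))) (Lc ^ m) (KInvStep (d := 3) (Lc ^ m) 0)) (Lc ^ m) (SN ((Lc ^ m) - 1) a (S (Lc ^ m)))) (W2NInf ((Lc ^ m) - 1) a (r (Lc ^ m)) (S₂ (Lc ^ m))) μ ν z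
          + 2 * hessKer idK1
          (fun κ' v => fun x y c b => ∑ κ : Fin 4, wsum (colH (coDressKBmAt (toSite (r (Lc ^ m))) (Lc ^ m) (KInvStep (d := 3) (Lc ^ m) 0)) (Lc ^ m) κ' v κ) (nFcol (r (Lc ^ m)) (Lc ^ m) κ) x y c b)
          (fun κ' v l v' => fun x y c b => ∑ κ : Fin 4, wsum (colH (coDressKBmAt (toSite (r (Lc ^ m))) (Lc ^ m) (KInvStep (d := 3) (Lc ^ m) 0)) (Lc ^ m) κ' v κ)
            (fun u => fun x y c b => colH (coDressKBmAt (toSite (r (Lc ^ m))) (Lc ^ m) (KInvStep (d := 3) (Lc ^ m) 0)) (Lc ^ m) l v' κ u * nFcol (r (Lc ^ m)) (Lc ^ m) κ u x y c b) x y c b)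
          μ ν z
          + RJ2 (Lc ^ m) μ ν z + RJ3 (Lc ^ m) μ ν z
          + ∑ i : GhIdx, ghostWordK (Ggh (Lc ^ m) a) (Pgt (Lc ^ m) a)
              (fun κ' v => (((Lc ^ m : ℕ) : ℝ) ^ 2) • (fun x y a b => ∑ κ : Fin 4,
                wsum (colH (coDressKBmAt (toSite (r (Lc ^ m))) (Lc ^ m) (KInvStep (d := 3) (Lc ^ m) 0)) (Lc ^ m) κ' v κ) (ghCur κ) x y a b))
              (fun κ' v l v' => (((Lc ^ m : ℕ) : ℝ) ^ 2) • (fun x y a b => ∑ κ : Fin 4,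
                wsum (colH (coDressKBmAt (toSite (r (Lc ^ m))) (Lc ^ m) (KInvStep (d := 3) (Lc ^ m) 0)) (Lc ^ m) κ' v κ)
                  (fun u => fun x y a b => colH (coDressKBmAt (toSite (r (Lc ^ m))) (Lc ^ m) (KInvStep (d := 3) (Lc ^ m) 0)) (Lc ^ m) l v' κ u * gh₂ κ u x y a b) x y a b))
              i μ ν z))
    (hMR : ∀ (u : υ) (m : ℕ), 1 ≤ m → AbsMoment₂ (Rk u (Lc ^ m) μ ν))
    (hRu : ∀ (u : υ) (m : ℕ), 1 ≤ m → |B12Beta.secondMoment (Rk u (Lc ^ m)) μ ν - Ru u (Lc ^ m)| ≤ CU' u)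
    (hU₁ : ∑ u, CU' u ≤ U₁)
    -- the RESCALED loop-weight tie of reading (ii): displayed scalar family `s`, pinned `s n = n⁻²`; the normalisation
    (s : ℕ → ℝ) (hs : ∀ n : ℕ, 2 ≤ n → s n = ((n : ℝ) ^ 2)⁻¹) (hωs : ∀ n : ℕ, 2 ≤ n → ωgh n * (s n * cK n) ^ 2 = -2 * (ωgl n * cE n ^ 2))
    (hlam : ∀ n : ℕ, 2 ≤ n → ωgl n * cE n ^ 2 = 2 * N ^ 2 * (n : ℝ) ^ 8)
    -- pins and the ray (the rows' letters)
    (hcE : ∀ n : ℕ, 2 ≤ n → cE n = (n : ℝ) ^ 4) (hRsgn : ∀ n : ℕ, 2 ≤ n → cR n = -cE n) (hJ4 : ∀ n : ℕ, cJ4 n = 0)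
    (hcgh : ∀ n : ℕ, |cgh n| ≤ cgh₀) (hKray : ∀ n : ℕ, cK n = cgh n * (n : ℝ) ^ 2) (hQray : ∀ n : ℕ, cQ n = cgh n * a) (hx : ∀ n : ℕ, x₀ n = -cgh n)
    -- slot-table sockets (the END's), covariance, bond swap; `hdiv` (the ghost Ward rows `hrowgh` are a THEOREM on the ray: discharged inside)
    (hδW : ∀ n, 0 < δW n)
    (hE : ∀ n κ u l u', BiLoc (WE n κ u l u') u u' (CE n) (δW n)) (hJ : ∀ n κ u l u', BiLoc (WJ n κ u l u') u u' (CJ n) (δW n))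
    (hΛ : ∀ n κ u l u', BiLoc (WΛ n κ u l u') u u' (CΛt n) (δW n)) (hR : ∀ n κ u l u', BiLoc (WR n κ u l u') u u' (CRt n) (δW n))
    (hQ : ∀ n κ u l u', BiLoc (WQ n κ u l u') u u' (CQ n) (δW n))
    (hEc : ∀ (n : ℕ) (κ : Fin 4) (u : Site 4) (l : Fin 4) (u' t : Site 4),
      WE n κ (u + (n : ℤ) • t) l (u' + (n : ℤ) • t) = shiftK (-((n : ℤ) • t)) (WE n κ u l u'))
    (hJc : ∀ (n : ℕ) (κ : Fin 4) (u : Site 4) (l : Fin 4) (u' t : Site 4),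
      WJ n κ (u + (n : ℤ) • t) l (u' + (n : ℤ) • t) = shiftK (-((n : ℤ) • t)) (WJ n κ u l u'))
    (hΛc : ∀ (n : ℕ) (κ : Fin 4) (u : Site 4) (l : Fin 4) (u' t : Site 4),
      WΛ n κ (u + (n : ℤ) • t) l (u' + (n : ℤ) • t) = shiftK (-((n : ℤ) • t)) (WΛ n κ u l u'))
    (hRc : ∀ (n : ℕ) (κ : Fin 4) (u : Site 4) (l : Fin 4) (u' t : Site 4),
      WR n κ (u + (n : ℤ) • t) l (u' + (n : ℤ) • t) = shiftK (-((n : ℤ) • t)) (WR n κ u l u'))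
    (hQc : ∀ (n : ℕ) (κ : Fin 4) (u : Site 4) (l : Fin 4) (u' t : Site 4),
      WQ n κ (u + (n : ℤ) • t) l (u' + (n : ℤ) • t) = shiftK (-((n : ℤ) • t)) (WQ n κ u l u'))
    (hEs : ∀ n κ u l u', WE n κ u l u' = WE n l u' κ u) (hJs : ∀ n κ u l u', WJ n κ u l u' = WJ n l u' κ u)
    (hΛs : ∀ n κ u l u', WΛ n κ u l u' = WΛ n l u' κ u) (hRs : ∀ n κ u l u', WR n κ u l u' = WR n l u' κ u)
    (hQs : ∀ n κ u l u', WQ n κ u l u' = WQ n l u' κ u)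
    (hdiv : ∀ n : ℕ, 2 ≤ n → ∀ [NeZero n], ∀ (l' : Fin 4) (u' u : Site 4), ∑ κ' : Fin 4,
      (fineHess n a (SbfBal n a (cE n) (cVH n) (cΛ n) (cR n) (cK n) (cQ n))
          (Wbf (cE₂ n) (cJ4 n) (cΛ₂ n) (cR₂ n) (cQ₂ n) (WE n) (WJ n) (WΛ n) (WR n) (WQ n)) κ' l' (u - Pi.single κ' 1) u'
        - fineHess n a (SbfBal n a (cE n) (cVH n) (cΛ n) (cR n) (cK n) (cQ n))
          (Wbf (cE₂ n) (cJ4 n) (cΛ₂ n) (cR₂ n) (cQ₂ n) (WE n) (WJ n) (WΛ n) (WR n) (WQ n)) κ' l' u u') = 0)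
    -- (LOCAL) slot-E support and units; slot-R envelope and units (the three local ghost bubbles are SUPPLIED under reading (ii))
    {ρE : ℕ} {δ₀ kE : ℝ} (hδ₀ : 0 < δ₀) (hδE : ∀ n, δ₀ ≤ δW n)
    (hsuppE : ∀ n κ u l u', ρE < supNorm (u - u') → WE n κ u l u' = 0)
    (hkE : ∀ n : ℕ, 2 ≤ n → |ωgl n * cE₂ n| * CE n ≤ kE * (n : ℝ) ^ 8)
    {CwR δR : ℕ → ℝ} {θR δ₀R kR : ℝ} (hθR : 0 < θR) (hδR : ∀ n, 0 < δR n) (hδ₀R : 0 < δ₀R) (hδRge : ∀ n : ℕ, δ₀R / n ≤ δR n) (hCwR : ∀ n, 0 ≤ CwR n)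
    (hWRenv : ∀ n κ u l u', BiLoc (WR n κ u l u') u u' (CwR n * Real.exp (-(θR / n) * supNorm (u - u'))) (δR n))
    (hkR : ∀ n : ℕ, 2 ≤ n → |ωgl n * cR₂ n| * CwR n * (n : ℝ) ^ 6 ≤ kR)
    -- (Λ) sockets and zero-momentum data
    (hδT : ∀ n, 0 < δT n)
    (hdec : ∀ n : ℕ, 2 ≤ n → ∀ [NeZero n], ∀ κ u l u', WΛ n κ u l u' =
      (∑ m : Fin 4, OneStepResolventKernel.wsum (onLat n (fun y => lamCoeffOf (KInv (N := n) (d := 3)) n m y l u'))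
          (fun v => onLat n (fun y => TΛ n m y κ u) v))
      + (∑ m : Fin 4, OneStepResolventKernel.wsum (onLat n (fun y => lamCoeffOf (KInv (N := n) (d := 3)) n m y κ u))
          (fun v => onLat n (fun y => TΛ n m y l u') v))
      + WA n κ u l u')
    (hTloc : ∀ (n : ℕ) m y κ u, BiLoc (TΛ n m y κ u) ((n : ℤ) • y) ((n : ℤ) • y) (CT n * Real.exp (-δT n * l1 ((n : ℤ) • y - u))) (δT n))
    (hWAa : ∀ n κ u l u', trK (WA n κ u l u') = -WA n κ u l u') (hWAl : ∀ n κ u l u', Loc (WA n κ u l u'))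
    (hTcov : ∀ (n : ℕ) m y κ u t, TΛ n m (y + t) κ (u + (n : ℤ) • t) = shiftK (-((n : ℤ) • t)) (TΛ n m y κ u))
    (hcΛ : ∀ n : ℕ, 2 ≤ n → cΛ n ≠ 0) (hε : ∀ n : ℕ, ε n = 1 ∨ ε n = -1) (hδx : ∀ n, 0 < δx n) (hX : ∀ n u, BiLoc (X n u) u u (Cx n) (δx n))
    (hW1 : ∀ n : ℕ, 2 ≤ n → ∀ [NeZero n], ∀ u,
      comp (comp (Ga n a) (divV (fun κ v => ε n • SbfBal n a (cE n) (cVH n) (cΛ n) (cR n) (cK n) (cQ n) κ v) u)) (Ga n a) =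
        comp (Ga n a) (X n u) - comp (X n u) (Ga n a))
    (hW2 : ∀ n : ℕ, 2 ≤ n → ∀ [NeZero n], ∀ (m : Fin 4) (u : Site 4),
      divV (fun κ v => (-(ε n * (cΛ₂ n / cΛ n))) • TΛ n m 0 κ v) u = comp (X n u) (ffOf (hessFF n m 0)) - comp (ffOf (hessFF n m 0)) (X n u))
    -- (N) slot Q's SOCKETS (the (A2) readout of `WQ`: a decaying bi-localisation envelope at a BLOCK-scale rate floor and its units line — T₈ ⟸ `NeedleTadpoleRowDecay`)
    {CwQ δQ : ℕ → ℝ} {θQ δ₀Q kQ : ℝ} (hθQ : 0 < θQ) (hδQ : ∀ n, 0 < δQ n) (hδ₀Q : 0 < δ₀Q) (hδQge : ∀ n : ℕ, δ₀Q / n ≤ δQ n) (hCwQ : ∀ n, 0 ≤ CwQ n)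
    (hWQenv : ∀ n κ u l u', BiLoc (WQ n κ u l u') u u' (CwQ n * Real.exp (-(θQ / n) * supNorm (u - u'))) (δQ n))
    (hkQ : ∀ n : ℕ, 2 ≤ n → |ωgl n * cQ₂ n| * CwQ n * (n : ℝ) ^ 6 ≤ kQ)
    -- (U)
    (hU : ∀ n : ℕ, 2 ≤ n → ∀ u, |Ru u n| ≤ CU u)
    -- base-point labels of the free one-shot side (the spine root's `hSL` ∕ `k`); the Literature's window data is discharged at `M := id`, `cc := 1`
    {L : Type*} {SL : Finset L} (hSL : SL.Nonempty) (k : L → Fin 4) :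
    D1Rep Lc Jc N μ ν a SL k :=
  d1Rep_BFx_of_D1Tel_ptw_sbpS Js hμν hN hL hodd ha h12 h126 Jc hW hRfl htel Rk
    (fun m hm z => by
      rw [hRk m hm z]
      exact hptw_of_junctions hL ha h12 h126 r hr S hS hCs hδS hScovB hSmm hSfm hSff S₂ hS₂ hCk hδ₂ hS₂covB hS₂mm hS₂fm hS₂ff μ ν p hp
        K₁ Q₁ x₁ K₂ Q₂ x₂ hK₁ hQ₁ hx₁ hK₂ hQ₂ hx₂ hK₁0 hQ₁0 hx₁0 hK₂0 hK₂0' hQ₂0 hQ₂0' hx₂0 hx₂0' C hC hP1 hP2 Jc hJ1 RJ2 RJ3 hJ2 hJ3 m hm z)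
    hMR hRu hU₁ s hs hωs hlam hcE hRsgn hJ4 hcgh hKray hQray hx hδW hE hJ hΛ hR hQ hEc hJc hΛc hRc hQc hEs hJs hΛs hRs hQs hdiv hδ₀ hδE hsuppE hkE hθR
    hδR hδ₀R hδRge hCwR hWRenv hkR hδT hdec hTloc hWAa hWAl hTcov hcΛ hε hδx hX hW1 hW2 hθQ hδQ hδ₀Q hδQge hCwQ hWQenv hkQ hU hSL k

end Summit.QuantumFields.BalabanUV.Beta.D1BFx.RoadEndBFxJunctionsS

end
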